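import Literature.ComputerArithmetic.Shewchuk1997.Orient2dStageA
import Literature.ComputerArithmetic.Shewchuk1997.FastExpansionSum
import Mathlib.Tactic.Linarith
import Mathlib.Tactic.Positivity
import Mathlib.Tactic.Ring
import Mathlib.Tactic.FieldSimp
import Mathlib.Tactic.NormNum

/-!
# A floating-point filter for INSPHERE: the filter and its constant

NEW WORK of this development (ENGINES group, unit `eng-quad-4`; HONEST FRAMING: shared numerical
engines serving client cells; rigour lives in the verifiers; every published number belongs to a
client cell's ledger, not to the engines group).  Not a published result, hence under
`Summits/Ventures/` with no citation tag of its own.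

Shewchuk's INSPHERE (is `e` inside the sphere through `a, b, c, d`?) is the sign of the `4 × 4`
determinant with rows `(a − e, |a − e|²)`, … [Shewchuk1997, §4.4]; the paper analyses the
stage-A filters of the three smaller predicates (Tables 1, 3, 5) but prints no error bound for
INSPHERE.  This file transcribes a stage-A filter for it in the style of Fig. 21 / Fig. 22 —
`insphereStageA fl K a… e…` — the structure being, as we understand it, that of the public-domain
`predicates.c` (`insphere()`; text not held, nothing is claimed about the C code): twelve rounded
differences, six `2 × 2` minors `ab, bc, cd, da, ac, bd`, four `3 × 3` minors
`abc = (aez ⊗ bc ⊖ bez ⊗ ac) ⊕ cez ⊗ ab`, `bcd = (bez ⊗ cd ⊖ cez ⊗ bd) ⊕ dez ⊗ bc`,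
`cda = (cez ⊗ da ⊕ dez ⊗ ac) ⊕ aez ⊗ cd`, `dab = (dez ⊗ ab ⊕ aez ⊗ bd) ⊕ bez ⊗ da`, four lifts
`(x ⊗ x ⊕ y ⊗ y) ⊕ z ⊗ z`, `det = (dlift ⊗ abc ⊖ clift ⊗ dab) ⊕ (blift ⊗ cda ⊖ alift ⊗ bcd)`, a
`permanent` obtained by replacing every entry by its absolute value and every subtraction by an
addition, `errbound = K ⊗ permanent`, and acceptance iff `det > errbound` or `−det > errbound`.

THE CONSTANT.  `isperrboundA p = (16 + 224ε)ε`, `ε = 2^−p` (the value we understand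
`predicates.c` to use; for binary64, `ε = 2^−53`).  `isperrboundA_margin` PROVES it sound: the
accumulated relative error of `det`, the polynomial
`15ε + 71ε² + 154ε³ + 201ε⁴ + 172ε⁵ + 99ε⁶ + 38ε⁷ + 9ε⁸ + ε⁹` of `InsphereFilterLemmas.lean`,
is at most `(1 − ε)¹⁰(16 + 224ε)ε` whenever `ε ≤ 1/64`, the factor `(1 − ε)¹⁰` paying for the
rounding of the permanent and of `errbound` (`sign_of_err_of_test`).  The correctness theorem —
sign of the returned value = sign of `insphereDet` — is `InsphereFilterCorrect.lean`.

HONEST SCOPE.  (i) The filter is a function on `ℚ` parameterised by a rounding `fl`; its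
correctness is proved for every round-to-nearest `fl` into a format `F(p, emin)`, `p ≥ 6`, and
float inputs far enough above underflow — see the correctness file for the exact hypotheses.
(ii) No optimality is claimed for `16 + 224ε`; the first-order constant of our analysis is `15`.
(iii) Only stage A (and, in `InsphereFilterCorrect.lean`, its composition with the exact stage of
`InsphereExact.lean`) is treated; the intermediate adaptive stages of `predicates.c` are not.

Reference: J. R. Shewchuk, Discrete Comput. Geom. 18 (1997) 305–363, §4.3–4.4 [Shewchuk1997].
-/

namespace Summit.Ventures.CertifiedArithmetic.Expansions

open Literature.ComputerArithmetic.JeannerodRump2018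
open Literature.ComputerArithmetic.Shewchuk1997

/-! ## The margin of the constant `(16 + 224ε)ε` and the sign conclusion -/

/-- The error-bound constant of the INSPHERE filter: `(16 + 224ε)ε`, `ε = 2^−p` (the shape of
Shewchuk's stage-A constants; the value we understand `predicates.c` to use). -/
def isperrboundA (p : ℕ) : ℚ := (16 + 224 * unitRoundoff p) * unitRoundoff p

/-- `isperrboundA = (16·2^p + 224)·2^(−2p)` lies on the grid `2^(−2p) ℤ` (it is a float of
precision `p ≥ 8`, in particular a binary64 number). -/
theorem onGrid_isperrboundA (p : ℕ) : OnGrid (-(2 * (p : ℤ))) (isperrboundA p) := by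
  refine ⟨16 * 2 ^ p + 224, ?_⟩
  unfold isperrboundA unitRoundoff
  have h2 : (2 : ℚ) ^ p ≠ 0 := pow_ne_zero _ (by norm_num)
  rw [show (-(2 * (p : ℤ))) = -((p : ℤ) + (p : ℤ)) by ring, zpow_neg, zpow_add₀ (by norm_num),
    zpow_natCast]
  push_cast
  field_simp

/-- `isperrboundA p ≥ 0`. -/
theorem isperrboundA_nonneg (p : ℕ) : 0 ≤ isperrboundA p := by
  unfold isperrboundA unitRoundoff
  positivity

/-- **The margin.**  For `0 ≤ u ≤ 1/64` the accumulated error polynomial is dominated: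
`15u + 71u² + 154u³ + 201u⁴ + 172u⁵ + 99u⁶ + 38u⁷ + 9u⁸ + u⁹ ≤ (1 − u)¹⁰(16 + 224u)u`.  The
difference is `u(1 − 7u − 1674u² + 7959u³ − 23692u⁴ + 42909u⁵ − 53126u⁶ + 45111u⁷ − 26161u⁸
+ 9920u⁹ − 2224u¹⁰ + 224u¹¹)`, and `1 − 7u − 1674u² ≥ 1 − 7/64 − 1674/4096 > 0`, the remaining
terms pairing up nonnegatively. -/
theorem isperrboundA_margin {u : ℚ} (hu0 : 0 ≤ u) (hu : u ≤ 1 / 64) :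
    15 * u + 71 * u ^ 2 + 154 * u ^ 3 + 201 * u ^ 4 + 172 * u ^ 5 + 99 * u ^ 6 + 38 * u ^ 7
        + 9 * u ^ 8 + u ^ 9 ≤ (1 - u) ^ 10 * ((16 + 224 * u) * u) := by
  have hkey : (1 - u) ^ 10 * ((16 + 224 * u) * u) - (15 * u + 71 * u ^ 2 + 154 * u ^ 3
      + 201 * u ^ 4 + 172 * u ^ 5 + 99 * u ^ 6 + 38 * u ^ 7 + 9 * u ^ 8 + u ^ 9) =
      u * (1 - 7 * u - 1674 * u ^ 2 + 7959 * u ^ 3 - 23692 * u ^ 4 + 42909 * u ^ 5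
        - 53126 * u ^ 6 + 45111 * u ^ 7 - 26161 * u ^ 8 + 9920 * u ^ 9 - 2224 * u ^ 10
        + 224 * u ^ 11) := by
    ring
  have hu2 : u ^ 2 ≤ u * (1 / 64) := by nlinarith
  have h1 : 0 ≤ 1 - 7 * u - 1674 * u ^ 2 := by nlinarith
  have h2 : 0 ≤ 7959 * u ^ 3 - 23692 * u ^ 4 := by
    have h : 0 ≤ 7959 - 23692 * u := by linarith
    have := mul_nonneg (pow_nonneg hu0 3) h
    linarith
  have h3 : 0 ≤ 42909 * u ^ 5 - 53126 * u ^ 6 := by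
    have h : 0 ≤ 42909 - 53126 * u := by linarith
    have := mul_nonneg (pow_nonneg hu0 5) h
    linarith
  have h4 : 0 ≤ 45111 * u ^ 7 - 26161 * u ^ 8 := by
    have h : 0 ≤ 45111 - 26161 * u := by linarith
    have := mul_nonneg (pow_nonneg hu0 7) h
    linarith
  have h5 : 0 ≤ 9920 * u ^ 9 - 2224 * u ^ 10 := by
    have h : 0 ≤ 9920 - 2224 * u := by linarith
    have := mul_nonneg (pow_nonneg hu0 9) h
    linarith
  have h6 : 0 ≤ 224 * u ^ 11 := by positivity
  have hpoly : 0 ≤ 1 - 7 * u - 1674 * u ^ 2 + 7959 * u ^ 3 - 23692 * u ^ 4 + 42909 * u ^ 5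
      - 53126 * u ^ 6 + 45111 * u ^ 7 - 26161 * u ^ 8 + 9920 * u ^ 9 - 2224 * u ^ 10
      + 224 * u ^ 11 := by linarith
  have := mul_nonneg hu0 hpoly
  rw [← hkey] at this
  linarith

/-- **From a passed test to the sign.**  If `|D − det| ≤ u|det| + X·M` with `X ≤ (1 − u)¹⁰K`,
the computed bound satisfies `E ≥ (1 − u)⁹KM` (`M ≥ 0`, `u < 1`) and the test `E < |det|`
passed, then `det` has the sign of `D`, strictly both ways. -/
theorem sign_of_err_of_test {u K det D M E X : ℚ} (hu1 : u < 1) (hM : 0 ≤ M)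
    (herr : |D - det| ≤ u * |det| + X * M) (hX : X ≤ (1 - u) ^ 10 * K)
    (hE : (1 - u) ^ 9 * K * M ≤ E) (htest : E < |det|) :
    (0 < det ↔ 0 < D) ∧ (det < 0 ↔ D < 0) := by
  have h1u : 0 < 1 - u := by linarith
  have hXM : X * M ≤ (1 - u) * ((1 - u) ^ 9 * K * M) := by
    have := mul_le_mul_of_nonneg_right hX hM
    calc X * M ≤ (1 - u) ^ 10 * K * M := this
      _ = (1 - u) * ((1 - u) ^ 9 * K * M) := by ring
  have hlt : |D - det| < |det| := by
    have h2 : (1 - u) * ((1 - u) ^ 9 * K * M) ≤ (1 - u) * E := mul_le_mul_of_nonneg_left hE h1u.le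
    have h3 : (1 - u) * E < (1 - u) * |det| := mul_lt_mul_of_pos_left htest h1u
    calc |D - det| ≤ u * |det| + X * M := herr
      _ < u * |det| + (1 - u) * |det| := by linarith
      _ = |det| := by ring
  have hlt' := abs_sub_lt_iff.mp hlt
  constructor
  · constructor
    · intro h
      rw [abs_of_pos h] at hlt'
      linarith [hlt'.2]
    · intro h
      by_contra hneg
      rw [abs_of_nonpos (not_lt.mp hneg)] at hlt'
      linarith [hlt'.1]
  · constructor
    · intro h
      rw [abs_of_neg h] at hlt'
      linarith [hlt'.1]
    · intro h
      by_contra hneg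
      rw [abs_of_nonneg (not_lt.mp hneg)] at hlt'
      linarith [hlt'.2]


/-! ## The transcription of the filter -/

/-- **INSPHERE, stage A** (structure of `predicates.c`'s `insphere()` as we understand it; every
operation rounded by `fl`).  Returns `some det` iff the test `det > errbound ∨ −det > errbound`
passes, `errbound = K ⊗ permanent`; `none` sends the caller to an exact (or adaptive) stage. -/
def insphereStageA (fl : ℚ → ℚ) (K : ℚ)
    (a₁ a₂ a₃ b₁ b₂ b₃ c₁ c₂ c₃ d₁ d₂ d₃ e₁ e₂ e₃ : ℚ) : Option ℚ :=
  let aex := fl (a₁ - e₁)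
  let bex := fl (b₁ - e₁)
  let cex := fl (c₁ - e₁)
  let dex := fl (d₁ - e₁)
  let aey := fl (a₂ - e₂)
  let bey := fl (b₂ - e₂)
  let cey := fl (c₂ - e₂)
  let dey := fl (d₂ - e₂)
  let aez := fl (a₃ - e₃)
  let bez := fl (b₃ - e₃)
  let cez := fl (c₃ - e₃)
  let dez := fl (d₃ - e₃)
  let aexbey := fl (aex * bey)
  let bexaey := fl (bex * aey)
  let bexcey := fl (bex * cey)
  let cexbey := fl (cex * bey)
  let cexdey := fl (cex * dey)
  let dexcey := fl (dex * cey)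
  let dexaey := fl (dex * aey)
  let aexdey := fl (aex * dey)
  let aexcey := fl (aex * cey)
  let cexaey := fl (cex * aey)
  let bexdey := fl (bex * dey)
  let dexbey := fl (dex * bey)
  let ab := fl (aexbey - bexaey)
  let bc := fl (bexcey - cexbey)
  let cd := fl (cexdey - dexcey)
  let da := fl (dexaey - aexdey)
  let ac := fl (aexcey - cexaey)
  let bd := fl (bexdey - dexbey)
  let abc := fl (fl (fl (aez * bc) - fl (bez * ac)) + fl (cez * ab))
  let bcd := fl (fl (fl (bez * cd) - fl (cez * bd)) + fl (dez * bc))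
  let cda := fl (fl (fl (cez * da) + fl (dez * ac)) + fl (aez * cd))
  let dab := fl (fl (fl (dez * ab) + fl (aez * bd)) + fl (bez * da))
  let alift := fl (fl (fl (aex * aex) + fl (aey * aey)) + fl (aez * aez))
  let blift := fl (fl (fl (bex * bex) + fl (bey * bey)) + fl (bez * bez))
  let clift := fl (fl (fl (cex * cex) + fl (cey * cey)) + fl (cez * cez))
  let dlift := fl (fl (fl (dex * dex) + fl (dey * dey)) + fl (dez * dez))
  let det :=
    fl (fl (fl (dlift * abc) - fl (clift * dab)) + fl (fl (blift * cda) - fl (alift * bcd)))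
  let abP := fl (|aexbey| + |bexaey|)
  let bcP := fl (|bexcey| + |cexbey|)
  let cdP := fl (|cexdey| + |dexcey|)
  let daP := fl (|dexaey| + |aexdey|)
  let acP := fl (|aexcey| + |cexaey|)
  let bdP := fl (|bexdey| + |dexbey|)
  let abcP := fl (fl (fl (bcP * |aez|) + fl (acP * |bez|)) + fl (abP * |cez|))
  let bcdP := fl (fl (fl (cdP * |bez|) + fl (bdP * |cez|)) + fl (bcP * |dez|))
  let cdaP := fl (fl (fl (daP * |cez|) + fl (acP * |dez|)) + fl (cdP * |aez|))
  let dabP := fl (fl (fl (abP * |dez|) + fl (bdP * |aez|)) + fl (daP * |bez|))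
  let permanent :=
    fl (fl (fl (fl (bcdP * alift) + fl (cdaP * blift)) + fl (dabP * clift)) + fl (abcP * dlift))
  let errbound := fl (K * permanent)
  if errbound < det ∨ errbound < -det then some det else none

end Summit.Ventures.CertifiedArithmetic.Expansions
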